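import Summits.CriticalPhenomena.PercolationContinuityZ3.Theorems.FK.EdgeDensityCovariance
import Summits.CriticalPhenomena.PercolationContinuityZ3.Theorems.FK.EdgeDensityDerivativeWeights
import Literature.Probability.LatticeModels.RandomClusterEdgeWeightsContinuity
import Literature.Probability.LatticeModels.RandomClusterEdgeWeightsHomogeneous
import Literature.Probability.LatticeModels.RandomClusterComparisonRatio
import Mathlib.Topology.Instances.ENNReal.Lemmas
import HarnessLib

/-!
# The margin-free Lipschitz bound in `p` for finite-volume random-cluster probabilities, uniformly in the
# boundary condition: `|φ^ξ_{F,p',q}(A) - φ^ξ_{F,p,q}(A)| ≤ q |F| |p' - p|` for all `p, p' ∈ [0, 1]` (`q ≥ 1`)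

Support file of the `fk-continuity` cell (FANOUT-PLAN.md row FO-09, follow-up; `--supports stmt-CriticalPhenomena-4575`);
builds on p205010 (kernel theorem, internal audit signed; external expert review pending).  Companion of
`EdgeDensityDerivative.lean` / `EdgeDensityDerivativeWeights.lean` (Grimmett 2006, Thm. (2.43): Lipschitz constant
`|F| / min{p(1-p), p'(1-p')}`, interior points only) and of `EdgeDensityCovariance.lean` (the abstract per-edge bound
`abs_tiltAvg_sub_tiltAvg_le_mul` for tilting weights with one-edge finite energy).

For the random-cluster weight `μ(ω) = (frozen off-region factor) · q^{k^B(ω)}` with `q ≥ 1`, opening an edge lowers `k^B`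
by at most one (Grimmett 2006, proof of (3.23)), so `q⁻¹ μ(ω) ≤ μ(ω ∪ {e}) ≤ μ(ω)`: the one-edge finite-energy property
with `Λ_hi = 1`, `Λ_lo = q⁻¹` (equivalently, Thm. (3.1) eq. (3.3): the conditional probability that `e` is open given
the rest is `p` or `p/(p + q(1-p))`).  Hence `|d/dp φ(A)| ≤ q |F|` uniformly in `p ∈ (0, 1)`, in the boundary condition,
in the wired set and in the event, and — passing to the end points by continuity of `𝐩 ↦ φ^B_{𝐩,q}(A)`
(`rcMeasureW_real_continuous`) — `|φ^ξ_{F,p',q}(A) - φ^ξ_{F,p,q}(A)| ≤ q |F| |p' - p|` for ALL `p, p' ∈ [0, 1]`.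
For `q ∈ [1, 2]` the constant is at most the `2|F|` of the tree's Bernoulli statement `SameP.abs_real_sub_real_le`
(`|P_{p'}(A) - P_p(A)| ≤ 2|F| |p' - p|`, all `p, p' ∈ [0, 1]`), so the FK continuation principle (cell row FO-11) can
move `p` in every step of an exploration exactly as at `q = 1`, with no margin `δ ≤ p ≤ 1 - δ` to carry.

## Contents (all proved; no named facts)

* `abs_rcMeasureW_real_sub_le_mul_of_mem_Ioo` — weights equal off `F`, constant `p`, `p' ∈ (0, 1)` on `F`;
* `abs_rcMeasureW_real_sub_le_mul` — the same for `p, p' ∈ [0, 1]` (closure of a Lipschitz bound under continuity);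
* `abs_rcMeasureW_condWeights_real_sub_le_mul` — the boundary-condition form (`condWeights`, every `ξ`), `p, p' ∈ [0, 1]`;
  `abs_rcMeasureW_condWeights_const_real_sub_le_mul` — the same for constant parameter vectors `p, p' : [0, 1]`;
* `abs_rcMeasure_real_sub_le_mul` — the homogeneous measure: `|φ^B_{G,p',q}(A) - φ^B_{G,p,q}(A)| ≤ q |E(G)| |p' - p|`,
  all `p, p' ∈ [0, 1]`, all wired sets `B`, `q ≥ 1`, events `A` (via `rcMeasure_eq_rcMeasureW`).

## References

* G. Grimmett, *The Random-Cluster Model*, Springer 2006: §2.5 Thm. (2.43) with eq. (2.44)–(2.45) (p. 40); §3.1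
  Thm. (3.1) eq. (3.3)–(3.4) (pp. 43–44, conditional edge probabilities / finite energy) and Thm. (3.7) (p. 44, boundary
  conditions on a region); §3.3 Thm. (3.12) eq. (3.13) (p. 46); §3.4 proof of (3.23) (p. 49: opening an edge lowers
  `k` by at most one); §1.4 eq. (1.20) (p. 15). [Grimmett2006]
* G. Grimmett, *Percolation*, 2nd ed., Springer 1999, §7.3 p. 162 (finite-dimensional probabilities are polynomials in
  `p`). [GrimmettPercolation1999]
-/

noncomputable section

namespace Summit.CriticalPhenomena.PercolationContinuityZ3.Theorems

namespace FK

open MeasureTheory Finset Literature.Probability.LatticeModels Literature.Probability.Percolation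
open Literature.Probability.Percolation.BHK2006 (weight ind_le_one)
open Literature.Probability.Percolation.DecisionTree (ind ind_nonneg ind_of_mem ind_of_not_mem)
open scoped Topology NNReal

/-! ### Random-cluster instances (`q ≥ 1`): the margin-free bound, on the closed interval `[0, 1]` -/

section EdgeWeights

open scoped Classical

variable {V : Type*} [Fintype V]

/-- **Margin-free Lipschitz continuity in the parameter of a region** (interior version): if two edge-parameter
vectors `w, w'` agree off the finite edge set `F` and are constant, `p` resp. `p'` in `(0, 1)`, on `F`, then for every
`q ≥ 1`, every wired set `B` and every event `A`, `|φ^B_{w',q}(A) - φ^B_{w,q}(A)| ≤ q |F| |p' - p|` — whatever the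
frozen parameters off `F` (Grimmett 2006, Thm. (2.43)/(2.45) with the one-edge conditional probabilities of Thm. (3.1)
eq. (3.3): `k^B` drops by at most one when an edge is opened, so `q^{-1} μ(ω) ≤ μ(ω ∪ {e}) ≤ μ(ω)` for the tilting
weight `μ = (off-F factor) · q^{k^B}`). [cite: Grimmett2006, Thm. (2.43) eq. (2.44)–(2.45) p. 40; Thm. (3.1) eq. (3.3) p. 43] -/
theorem abs_rcMeasureW_real_sub_le_mul_of_mem_Ioo {w w' : Sym2 V → unitInterval} {F : Finset (Sym2 V)}
    {p p' : ℝ} (hp : p ∈ Set.Ioo (0 : ℝ) 1) (hp' : p' ∈ Set.Ioo (0 : ℝ) 1) (hw : ∀ e ∈ F, (w e : ℝ) = p)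
    (hw' : ∀ e ∈ F, (w' e : ℝ) = p') (hoff : ∀ e, e ∉ F → w' e = w e) {q : ℝ} (hq : 1 ≤ q) (B : Set V)
    (A : Set (BondConfig V)) :
    |(rcMeasureW w' q B).real A - (rcMeasureW w q B).real A| ≤ q * #F * |p' - p| := by
  have hq0 : 0 < q := one_pos.trans_le hq
  -- both weights belong to the same tilted family
  have hμ' : ∀ ω : BondConfig V, (∏ e ∈ Fᶜ, (if e ∈ ω then (w' e : ℝ) else 1 - w' e)) =
      ∏ e ∈ Fᶜ, (if e ∈ ω then (w e : ℝ) else 1 - w e) := fun ω =>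
    Finset.prod_congr rfl fun e he => by rw [hoff e (Finset.mem_compl.1 he)]
  have hW : ∀ ω : BondConfig V, rcWeightW w q B ω = p ^ #(F.filter (· ∈ ω)) * (1 - p) ^ #(F.filter (· ∉ ω)) *
      ((∏ e ∈ Fᶜ, (if e ∈ ω then (w e : ℝ) else 1 - w e)) * q ^ clusterCount ω B) :=
    fun ω => rcWeightW_eq_of_eq_on hw q B ω
  have hW' : ∀ ω : BondConfig V, rcWeightW w' q B ω = p' ^ #(F.filter (· ∈ ω)) * (1 - p') ^ #(F.filter (· ∉ ω)) *
      ((∏ e ∈ Fᶜ, (if e ∈ ω then (w e : ℝ) else 1 - w e)) * q ^ clusterCount ω B) := fun ω => by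
    rw [rcWeightW_eq_of_eq_on hw' q B ω, hμ']
  -- nonnegativity of the off-`F` factor
  have hP : ∀ ω : BondConfig V, 0 ≤ ∏ e ∈ Fᶜ, (if e ∈ ω then (w e : ℝ) else 1 - w e) := fun ω =>
    Finset.prod_nonneg fun e _ => by
      split_ifs
      · exact (w e).2.1
      · exact sub_nonneg.2 (w e).2.2
  -- the off-`F` factor does not see the state of an edge of `F`
  -- (stated for `s = ω ∪ {e}` so that the decidability instances are the generic ones)
  have hPins : ∀ e ∈ F, ∀ ω s : BondConfig V, s = insert e ω →
      (∏ f ∈ Fᶜ, (if f ∈ s then (w f : ℝ) else 1 - w f)) =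
        ∏ f ∈ Fᶜ, (if f ∈ ω then (w f : ℝ) else 1 - w f) := by
    intro e he ω s hs
    refine Finset.prod_congr rfl fun f hf => ?_
    have hfe : f ≠ e := fun h => (Finset.mem_compl.1 hf) (h ▸ he)
    by_cases hfω : f ∈ ω
    · rw [if_pos hfω, if_pos (hs ▸ Set.mem_insert_of_mem e hfω)]
    · have hfs : f ∉ s := fun h => hfω ((Set.mem_insert_iff.1 (hs ▸ h)).resolve_left hfe)
      rw [if_neg hfω, if_neg hfs]
  rw [rcMeasureW_real_eq_sum_div w' hq0 B A, rcMeasureW_real_eq_sum_div w hq0 B A, rcPartitionFunctionW,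
    rcPartitionFunctionW]
  simp only [hW, hW']
  -- the exponents `a = |ω ∩ F|`, `b = |F ∖ ω|`
  have ha : ∀ ω : BondConfig V, ((#(F.filter (· ∈ ω)) : ℕ) : ℝ) = ∑ e ∈ F, (if e ∈ ω then (1 : ℝ) else 0) := by
    intro ω
    rw [Finset.card_filter]
    push_cast
    rfl
  have hab : ∀ ω : BondConfig V, #(F.filter (· ∈ ω)) + #(F.filter (· ∉ ω)) = #F := fun ω =>
    Finset.card_filter_add_card_filter_not _
  have key := abs_tiltAvg_sub_tiltAvg_le_mul F
    (a := fun ω : BondConfig V => #(F.filter (· ∈ ω))) (b := fun ω : BondConfig V => #(F.filter (· ∉ ω)))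
    (μ := fun ω : BondConfig V => (∏ e ∈ Fᶜ, (if e ∈ ω then (w e : ℝ) else 1 - w e)) * q ^ clusterCount ω B)
    (Λlo := q⁻¹) (Λhi := 1) (ind A) ha hab (fun ω => mul_nonneg (hP ω) (pow_nonneg hq0.le _)) ?_
    (fun ω => ⟨ind_nonneg A ω, ind_le_one A ω⟩) (inv_pos.2 hq0) (inv_le_one_of_one_le₀ hq) le_rfl ?_ ?_ hp hp'
  · rw [one_div, inv_inv] at key
    exact key
  · -- `μ` has a positive entry: the configuration `{e | w_e > 1/2}`
    refine ⟨{e | (1 / 2 : ℝ) < w e}, mul_pos (Finset.prod_pos fun e _ => ?_) (pow_pos hq0 _)⟩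
    by_cases he : (1 / 2 : ℝ) < w e
    · rw [if_pos (show e ∈ {e | (1 / 2 : ℝ) < w e} from he)]; linarith
    · rw [if_neg (show e ∉ {e | (1 / 2 : ℝ) < w e} from he)]; linarith [not_lt.1 he]
  · -- upper flip: `k^B(ω ∪ {e}) ≤ k^B(ω)` and `q ≥ 1`
    intro e he ω hω
    rw [one_mul, hPins e he ω (insert e ω) rfl]
    exact mul_le_mul_of_nonneg_left
      (pow_le_pow_right₀ hq (clusterCount_anti (Set.subset_insert e ω) B)) (hP ω)
  · -- lower flip: `k^B(ω) ≤ k^B(ω ∪ {e}) + 1`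
    intro e he ω hω
    rw [hPins e he ω (insert e ω) rfl]
    have hk : q ^ clusterCount ω B ≤ q ^ clusterCount (insert e ω) B * q := by
      rw [← pow_succ]
      exact pow_le_pow_right₀ hq (clusterCount_le_clusterCount_insert_edge_add_one ω e B)
    have hqk : 0 ≤ q ^ clusterCount (insert e ω) B := pow_nonneg hq0.le _
    calc q⁻¹ * ((∏ f ∈ Fᶜ, (if f ∈ ω then (w f : ℝ) else 1 - w f)) * q ^ clusterCount ω B)
        ≤ q⁻¹ * ((∏ f ∈ Fᶜ, (if f ∈ ω then (w f : ℝ) else 1 - w f)) * (q ^ clusterCount (insert e ω) B * q)) :=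
          mul_le_mul_of_nonneg_left (mul_le_mul_of_nonneg_left hk (hP ω)) (inv_nonneg.2 hq0.le)
      _ = (∏ f ∈ Fᶜ, (if f ∈ ω then (w f : ℝ) else 1 - w f)) * q ^ clusterCount (insert e ω) B := by
          field_simp

/-- **Margin-free Lipschitz continuity in the parameter of a region, on the closed interval** (the end points by
continuity of `𝐩 ↦ φ^B_{𝐩,q}(A)`, `rcMeasureW_real_continuous`): for edge-parameter vectors `w, w'` equal off `F` and
constant `p`, `p' ∈ [0, 1]` on `F`, every `q ≥ 1`, wired set `B` and event `A`,
`|φ^B_{w',q}(A) - φ^B_{w,q}(A)| ≤ q |F| |p' - p|`.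
[cite: Grimmett2006, Thm. (2.43) eq. (2.44)–(2.45) p. 40; Thm. (3.1) eq. (3.3) p. 43] -/
theorem abs_rcMeasureW_real_sub_le_mul {w w' : Sym2 V → unitInterval} {F : Finset (Sym2 V)} {p p' : ℝ}
    (hp : p ∈ Set.Icc (0 : ℝ) 1) (hp' : p' ∈ Set.Icc (0 : ℝ) 1) (hw : ∀ e ∈ F, (w e : ℝ) = p)
    (hw' : ∀ e ∈ F, (w' e : ℝ) = p') (hoff : ∀ e, e ∉ F → w' e = w e) {q : ℝ} (hq : 1 ≤ q) (B : Set V)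
    (A : Set (BondConfig V)) :
    |(rcMeasureW w' q B).real A - (rcMeasureW w q B).real A| ≤ q * #F * |p' - p| := by
  have hq0 : 0 < q := one_pos.trans_le hq
  have hK : (0 : ℝ) ≤ q * #F := by positivity
  -- the path `r ↦ 𝐩(r)`: `r` (projected to `[0, 1]`) on `F`, the frozen parameters of `w` off `F`
  set path : ℝ → Sym2 V → unitInterval := fun r e =>
    if e ∈ F then Set.projIcc (0 : ℝ) 1 zero_le_one r else w e with hpath
  have hon : ∀ r, ∀ e ∈ F, ((path r e : unitInterval) : ℝ) = max 0 (min 1 r) := fun r e he => by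
    simp only [hpath, he, if_true, Set.coe_projIcc]
  have hoff' : ∀ r e, e ∉ F → path r e = w e := fun r e he => by
    simp only [hpath, he, if_false]
  set f : ℝ → ℝ := fun r => (rcMeasureW (path r) q B).real A with hf
  have hcont : Continuous f := by
    refine (rcMeasureW_real_continuous hq0 B A).comp (continuous_pi fun e => ?_)
    by_cases he : e ∈ F
    · simp only [hpath, he, if_true]
      exact continuous_projIcc
    · simp only [hpath, he, if_false]
      exact continuous_const
  -- Lipschitz on the open interval (interior version), hence on its closure `[0, 1]`
  have hlip : LipschitzOnWith (Real.toNNReal (q * #F)) f (Set.Ioo (0 : ℝ) 1) := by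
    refine LipschitzOnWith.of_dist_le' fun x hx y hy => ?_
    rw [Real.dist_eq, Real.dist_eq]
    have hx' : ∀ e ∈ F, ((path x e : unitInterval) : ℝ) = x := fun e he => by
      rw [hon x e he, min_eq_right hx.2.le, max_eq_right hx.1.le]
    have hy' : ∀ e ∈ F, ((path y e : unitInterval) : ℝ) = y := fun e he => by
      rw [hon y e he, min_eq_right hy.2.le, max_eq_right hy.1.le]
    exact abs_rcMeasureW_real_sub_le_mul_of_mem_Ioo hy hx hy' hx'
      (fun e he => by rw [hoff' x e he, hoff' y e he]) hq B A
  have hlip' := (hlip.closure (hcont.continuousOn)).dist_le_mul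
  rw [closure_Ioo zero_ne_one] at hlip'
  have key := hlip' p' hp' p hp
  rw [Real.dist_eq, Real.dist_eq, Real.coe_toNNReal _ hK] at key
  -- the end points of the path are `w'` and `w`
  have hfp : path p = w := by
    funext e
    by_cases he : e ∈ F
    · apply Subtype.ext
      rw [hon p e he, hw e he, min_eq_right hp.2, max_eq_right hp.1]
    · exact hoff' p e he
  have hfp' : path p' = w' := by
    funext e
    by_cases he : e ∈ F
    · apply Subtype.ext
      rw [hon p' e he, hw' e he, min_eq_right hp'.2, max_eq_right hp'.1]
    · rw [hoff' p' e he, hoff e he]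
  simpa only [hf, hfp, hfp'] using key

/-- **Boundary-condition-uniform, margin-free Lipschitz continuity in `p`** (Grimmett 2006, Thm. (2.43)/(2.45) with
Thm. (3.1) eq. (3.3), in the boundary-condition language of Thm. (3.7) / Lemma (4.13) as rendered by the tree's
`condWeights`): for a finite region `F` with parameter `p` (resp. `p'`) in `[0, 1]` on `F`, ANY configuration `ξ` off `F`
acting as boundary condition, any wired set `B`, any `q ≥ 1` and any event `A`,
`|φ^{ξ,B}_{F,p',q}(A) - φ^{ξ,B}_{F,p,q}(A)| ≤ q |F| |p' - p|` — for `q ∈ [1, 2]` at most the constant `2|F|` of the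
Bernoulli statement `SameP.abs_real_sub_real_le`. [cite: Grimmett2006, Thm. (2.43) eq. (2.44)–(2.45) p. 40; Thm. (3.1) eq. (3.3) p. 43; Thm. (3.7) p. 44] -/
theorem abs_rcMeasureW_condWeights_real_sub_le_mul {w w' : Sym2 V → unitInterval} {F : Finset (Sym2 V)}
    {p p' : ℝ} (hp : p ∈ Set.Icc (0 : ℝ) 1) (hp' : p' ∈ Set.Icc (0 : ℝ) 1) (hw : ∀ e ∈ F, (w e : ℝ) = p)
    (hw' : ∀ e ∈ F, (w' e : ℝ) = p') (ξ : Set (Sym2 V)) {q : ℝ} (hq : 1 ≤ q) (B : Set V)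
    (A : Set (BondConfig V)) :
    |(rcMeasureW (condWeights w' ↑F ξ) q B).real A - (rcMeasureW (condWeights w ↑F ξ) q B).real A| ≤
      q * #F * |p' - p| := by
  refine abs_rcMeasureW_real_sub_le_mul hp hp' (fun e he => ?_) (fun e he => ?_) (fun e he => ?_) hq B A
  · rw [← hw e he]; simp [condWeights, he]
  · rw [← hw' e he]; simp [condWeights, he]
  · simp [condWeights, he]


/-- The same bound for the constant parameter vectors `p, p' : [0, 1]` on the region (the shape of the tree's Bernoulli
statement `SameP.abs_real_sub_real_le (p q : unitInterval)`): for every boundary condition `ξ` off `F`, wired set `B`,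
`q ≥ 1` and event `A`, `|φ^{ξ,B}_{F,p',q}(A) - φ^{ξ,B}_{F,p,q}(A)| ≤ q |F| |p' - p|`.
[cite: Grimmett2006, Thm. (2.43) eq. (2.44)–(2.45) p. 40; Thm. (3.1) eq. (3.3) p. 43; Thm. (3.7) p. 44] -/
theorem abs_rcMeasureW_condWeights_const_real_sub_le_mul (p p' : unitInterval) (F : Finset (Sym2 V))
    (ξ : Set (Sym2 V)) {q : ℝ} (hq : 1 ≤ q) (B : Set V) (A : Set (BondConfig V)) :
    |(rcMeasureW (condWeights (fun _ => p') ↑F ξ) q B).real A -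
        (rcMeasureW (condWeights (fun _ => p) ↑F ξ) q B).real A| ≤ q * #F * |(p' : ℝ) - p| :=
  abs_rcMeasureW_condWeights_real_sub_le_mul p.2 p'.2 (fun _ _ => rfl) (fun _ _ => rfl) ξ hq B A

end EdgeWeights

section Homogeneous

variable {V : Type*} [Fintype V] [DecidableEq V] (G : SimpleGraph V) [DecidableRel G.Adj]

/-- **Margin-free Lipschitz continuity in `p` of finite-volume random-cluster probabilities** (homogeneous measure
`φ^B_{G,p,q} = rcMeasure G p q B`, via `rcMeasure_eq_rcMeasureW`): for `q ≥ 1`, ANY wired set `B`, ANY event `A` and ALL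
`p, p' ∈ [0, 1]`, `|φ^B_{G,p',q}(A) - φ^B_{G,p,q}(A)| ≤ q |E(G)| |p' - p|` (compare `abs_rcMeasure_real_sub_le`: constant
`|E(G)| / min{p(1-p), p'(1-p')}`, interior points only).
[cite: Grimmett2006, Thm. (2.43) eq. (2.44)–(2.45) p. 40; Thm. (3.1) eq. (3.3) p. 43; Thm. (3.12) eq. (3.13) p. 46] -/
theorem abs_rcMeasure_real_sub_le_mul {q : ℝ} (hq : 1 ≤ q) (B : Set V) (A : Set (BondConfig V)) {p p' : ℝ}
    (hp : p ∈ Set.Icc (0 : ℝ) 1) (hp' : p' ∈ Set.Icc (0 : ℝ) 1) :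
    |(rcMeasure G p' q B).real A - (rcMeasure G p q B).real A| ≤ q * #G.edgeFinset * |p' - p| := by
  have hq0 : 0 < q := one_pos.trans_le hq
  rw [show rcMeasure G p q B = rcMeasureW (edgeIndicatorWeights G ⟨p, hp⟩) q B from
      rcMeasure_eq_rcMeasureW G (⟨p, hp⟩ : unitInterval) hq0 B,
    show rcMeasure G p' q B = rcMeasureW (edgeIndicatorWeights G ⟨p', hp'⟩) q B from
      rcMeasure_eq_rcMeasureW G (⟨p', hp'⟩ : unitInterval) hq0 B]
  refine abs_rcMeasureW_real_sub_le_mul hp hp' (F := G.edgeFinset) (fun e he => ?_) (fun e he => ?_)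
    (fun e he => ?_) hq B A
  · have heE : e ∈ G.edgeSet := SimpleGraph.mem_edgeFinset.1 he
    simp [edgeIndicatorWeights, heE]
  · have heE : e ∈ G.edgeSet := SimpleGraph.mem_edgeFinset.1 he
    simp [edgeIndicatorWeights, heE]
  · have heE : e ∉ G.edgeSet := fun h => he (SimpleGraph.mem_edgeFinset.2 h)
    simp [edgeIndicatorWeights, heE]

end Homogeneous

end FK

end Summit.CriticalPhenomena.PercolationContinuityZ3.Theorems

end
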